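import Summits.Ventures.QEC.Census.CertChunks
import Summits.Ventures.QEC.Census.BB.BB144.BZAutInfoSetsZ1
import Summits.Ventures.QEC.Census.BB.BB144.BZAutBoundsZ
import Summits.Ventures.QEC.Census.BB.BB144.BZAutEnumZ01
import Summits.Ventures.QEC.Census.BB.BB144.BZAutEnumZ02
import Summits.Ventures.QEC.Census.BB.BB144.BZAutEnumZ03
import Summits.Ventures.QEC.Census.BB.BB144.BZAutEnumZ04
import Summits.Ventures.QEC.Census.BB.BB144.BZAutEnumZ05
import Summits.Ventures.QEC.Census.BB.BB144.BZAutEnumZ06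
import Summits.Ventures.QEC.Census.BB.BB144.BZAutEnumZ07
import Summits.Ventures.QEC.Census.BB.BB144.BZAutEnumZ08
import HarnessLib

/-!
# `BB144` — `bz_aut` certificate (7c1e929a), side Z: every BLOCK passes type-10's block check (emitted by qec-search-7)

For each of the 15 blocks `b`: `BB144.cert.bzZBlock BB144.bzAutData b = true`, recombined by
`CertBZInfoSets.bzZBlock_of_parts` from the KERNEL information-set facts `autSysZ_b_i` (`BZAutInfoSetsZ1`), the
COMPILED enumeration verdicts `enumZ_b_i` (`BZAutEnumZ01 … 08`, `native_decide`, re-executed by the gate's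
compute-cert lane) and the KERNEL bounds `autBoundZ_b` (`BZAutBoundsZ`); then `autBlocksZ_all : ∀ b < 15, …` — the
block hypothesis of type-10's `CertCheckBZAut` closer for route item stmt-Ventures-19772 (NoZLogicalBelowTwelve).
Tier of this file = COMPILED (CHECKED-native) by inheritance from the enumeration verdicts; no `native_decide` here.
-/

namespace Summit.Ventures.QEC.Census.BB144

/-- Block 0 of the `bz_aut` certificate passes type-10's block check (from its parts). -/
theorem autBlkZ_0 : BB144.cert.bzZBlock BB144.bzAutData 0 = true :=
  BB144.cert.bzZBlock_of_parts BB144.bzAutData (b := 0) (blk := bzAutBlockZ0) rfl rfl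
    (forall_lt_append (forall_lt_append (forall_lt_zero) (forall_lt_single 0 autSysZ_0_0)) (forall_lt_single 1 autSysZ_0_1))
    (forall_lt_append (forall_lt_append (forall_lt_zero) (forall_lt_single 0 enumZ_0_0)) (forall_lt_single 1 enumZ_0_1))
    autBoundZ_0

/-- Block 1 of the `bz_aut` certificate passes type-10's block check (from its parts). -/
theorem autBlkZ_1 : BB144.cert.bzZBlock BB144.bzAutData 1 = true :=
  BB144.cert.bzZBlock_of_parts BB144.bzAutData (b := 1) (blk := bzAutBlockZ1) rfl rfl
    (forall_lt_append (forall_lt_append (forall_lt_zero) (forall_lt_single 0 autSysZ_1_0)) (forall_lt_single 1 autSysZ_1_1))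
    (forall_lt_append (forall_lt_append (forall_lt_zero) (forall_lt_single 0 enumZ_1_0)) (forall_lt_single 1 enumZ_1_1))
    autBoundZ_1

/-- Block 2 of the `bz_aut` certificate passes type-10's block check (from its parts). -/
theorem autBlkZ_2 : BB144.cert.bzZBlock BB144.bzAutData 2 = true :=
  BB144.cert.bzZBlock_of_parts BB144.bzAutData (b := 2) (blk := bzAutBlockZ2) rfl rfl
    (forall_lt_append (forall_lt_append (forall_lt_zero) (forall_lt_single 0 autSysZ_2_0)) (forall_lt_single 1 autSysZ_2_1))
    (forall_lt_append (forall_lt_append (forall_lt_zero) (forall_lt_single 0 enumZ_2_0)) (forall_lt_single 1 enumZ_2_1))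
    autBoundZ_2

/-- Block 3 of the `bz_aut` certificate passes type-10's block check (from its parts). -/
theorem autBlkZ_3 : BB144.cert.bzZBlock BB144.bzAutData 3 = true :=
  BB144.cert.bzZBlock_of_parts BB144.bzAutData (b := 3) (blk := bzAutBlockZ3) rfl rfl
    (forall_lt_append (forall_lt_append (forall_lt_zero) (forall_lt_single 0 autSysZ_3_0)) (forall_lt_single 1 autSysZ_3_1))
    (forall_lt_append (forall_lt_append (forall_lt_zero) (forall_lt_single 0 enumZ_3_0)) (forall_lt_single 1 enumZ_3_1))
    autBoundZ_3

/-- Block 4 of the `bz_aut` certificate passes type-10's block check (from its parts). -/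
theorem autBlkZ_4 : BB144.cert.bzZBlock BB144.bzAutData 4 = true :=
  BB144.cert.bzZBlock_of_parts BB144.bzAutData (b := 4) (blk := bzAutBlockZ4) rfl rfl
    (forall_lt_append (forall_lt_append (forall_lt_zero) (forall_lt_single 0 autSysZ_4_0)) (forall_lt_single 1 autSysZ_4_1))
    (forall_lt_append (forall_lt_append (forall_lt_zero) (forall_lt_single 0 enumZ_4_0)) (forall_lt_single 1 enumZ_4_1))
    autBoundZ_4

/-- Block 5 of the `bz_aut` certificate passes type-10's block check (from its parts). -/
theorem autBlkZ_5 : BB144.cert.bzZBlock BB144.bzAutData 5 = true :=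
  BB144.cert.bzZBlock_of_parts BB144.bzAutData (b := 5) (blk := bzAutBlockZ5) rfl rfl
    (forall_lt_append (forall_lt_append (forall_lt_zero) (forall_lt_single 0 autSysZ_5_0)) (forall_lt_single 1 autSysZ_5_1))
    (forall_lt_append (forall_lt_append (forall_lt_zero) (forall_lt_single 0 enumZ_5_0)) (forall_lt_single 1 enumZ_5_1))
    autBoundZ_5

/-- Block 6 of the `bz_aut` certificate passes type-10's block check (from its parts). -/
theorem autBlkZ_6 : BB144.cert.bzZBlock BB144.bzAutData 6 = true :=
  BB144.cert.bzZBlock_of_parts BB144.bzAutData (b := 6) (blk := bzAutBlockZ6) rfl rfl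
    (forall_lt_append (forall_lt_append (forall_lt_zero) (forall_lt_single 0 autSysZ_6_0)) (forall_lt_single 1 autSysZ_6_1))
    (forall_lt_append (forall_lt_append (forall_lt_zero) (forall_lt_single 0 enumZ_6_0)) (forall_lt_single 1 enumZ_6_1))
    autBoundZ_6

/-- Block 7 of the `bz_aut` certificate passes type-10's block check (from its parts). -/
theorem autBlkZ_7 : BB144.cert.bzZBlock BB144.bzAutData 7 = true :=
  BB144.cert.bzZBlock_of_parts BB144.bzAutData (b := 7) (blk := bzAutBlockZ7) rfl rfl
    (forall_lt_append (forall_lt_append (forall_lt_zero) (forall_lt_single 0 autSysZ_7_0)) (forall_lt_single 1 autSysZ_7_1))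
    (forall_lt_append (forall_lt_append (forall_lt_zero) (forall_lt_single 0 enumZ_7_0)) (forall_lt_single 1 enumZ_7_1))
    autBoundZ_7

/-- Block 8 of the `bz_aut` certificate passes type-10's block check (from its parts). -/
theorem autBlkZ_8 : BB144.cert.bzZBlock BB144.bzAutData 8 = true :=
  BB144.cert.bzZBlock_of_parts BB144.bzAutData (b := 8) (blk := bzAutBlockZ8) rfl rfl
    (forall_lt_append (forall_lt_append (forall_lt_zero) (forall_lt_single 0 autSysZ_8_0)) (forall_lt_single 1 autSysZ_8_1))
    (forall_lt_append (forall_lt_append (forall_lt_zero) (forall_lt_single 0 enumZ_8_0)) (forall_lt_single 1 enumZ_8_1))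
    autBoundZ_8

/-- Block 9 of the `bz_aut` certificate passes type-10's block check (from its parts). -/
theorem autBlkZ_9 : BB144.cert.bzZBlock BB144.bzAutData 9 = true :=
  BB144.cert.bzZBlock_of_parts BB144.bzAutData (b := 9) (blk := bzAutBlockZ9) rfl rfl
    (forall_lt_append (forall_lt_append (forall_lt_zero) (forall_lt_single 0 autSysZ_9_0)) (forall_lt_single 1 autSysZ_9_1))
    (forall_lt_append (forall_lt_append (forall_lt_zero) (forall_lt_single 0 enumZ_9_0)) (forall_lt_single 1 enumZ_9_1))
    autBoundZ_9

/-- Block 10 of the `bz_aut` certificate passes type-10's block check (from its parts). -/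
theorem autBlkZ_10 : BB144.cert.bzZBlock BB144.bzAutData 10 = true :=
  BB144.cert.bzZBlock_of_parts BB144.bzAutData (b := 10) (blk := bzAutBlockZ10) rfl rfl
    (forall_lt_append (forall_lt_append (forall_lt_zero) (forall_lt_single 0 autSysZ_10_0)) (forall_lt_single 1 autSysZ_10_1))
    (forall_lt_append (forall_lt_append (forall_lt_zero) (forall_lt_single 0 enumZ_10_0)) (forall_lt_single 1 enumZ_10_1))
    autBoundZ_10

/-- Block 11 of the `bz_aut` certificate passes type-10's block check (from its parts). -/
theorem autBlkZ_11 : BB144.cert.bzZBlock BB144.bzAutData 11 = true :=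
  BB144.cert.bzZBlock_of_parts BB144.bzAutData (b := 11) (blk := bzAutBlockZ11) rfl rfl
    (forall_lt_append (forall_lt_append (forall_lt_zero) (forall_lt_single 0 autSysZ_11_0)) (forall_lt_single 1 autSysZ_11_1))
    (forall_lt_append (forall_lt_append (forall_lt_zero) (forall_lt_single 0 enumZ_11_0)) (forall_lt_single 1 enumZ_11_1))
    autBoundZ_11

/-- Block 12 of the `bz_aut` certificate passes type-10's block check (from its parts). -/
theorem autBlkZ_12 : BB144.cert.bzZBlock BB144.bzAutData 12 = true :=
  BB144.cert.bzZBlock_of_parts BB144.bzAutData (b := 12) (blk := bzAutBlockZ12) rfl rfl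
    (forall_lt_append (forall_lt_append (forall_lt_zero) (forall_lt_single 0 autSysZ_12_0)) (forall_lt_single 1 autSysZ_12_1))
    (forall_lt_append (forall_lt_append (forall_lt_zero) (forall_lt_single 0 enumZ_12_0)) (forall_lt_single 1 enumZ_12_1))
    autBoundZ_12

/-- Block 13 of the `bz_aut` certificate passes type-10's block check (from its parts). -/
theorem autBlkZ_13 : BB144.cert.bzZBlock BB144.bzAutData 13 = true :=
  BB144.cert.bzZBlock_of_parts BB144.bzAutData (b := 13) (blk := bzAutBlockZ13) rfl rfl
    (forall_lt_append (forall_lt_append (forall_lt_zero) (forall_lt_single 0 autSysZ_13_0)) (forall_lt_single 1 autSysZ_13_1))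
    (forall_lt_append (forall_lt_append (forall_lt_zero) (forall_lt_single 0 enumZ_13_0)) (forall_lt_single 1 enumZ_13_1))
    autBoundZ_13

/-- Block 14 of the `bz_aut` certificate passes type-10's block check (from its parts). -/
theorem autBlkZ_14 : BB144.cert.bzZBlock BB144.bzAutData 14 = true :=
  BB144.cert.bzZBlock_of_parts BB144.bzAutData (b := 14) (blk := bzAutBlockZ14) rfl rfl
    (forall_lt_append (forall_lt_append (forall_lt_zero) (forall_lt_single 0 autSysZ_14_0)) (forall_lt_single 1 autSysZ_14_1))
    (forall_lt_append (forall_lt_append (forall_lt_zero) (forall_lt_single 0 enumZ_14_0)) (forall_lt_single 1 enumZ_14_1))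
    autBoundZ_14

/-- **All 15 blocks of the `bz_aut` certificate of `[[144,12,12]]` pass** (the `hb` hypothesis of the `bz`/`bz_aut`
soundness theorems; tier COMPILED). -/
theorem autBlocksZ_all : ∀ b, b < 15 → BB144.cert.bzZBlock BB144.bzAutData b = true :=
  forall_lt_append (forall_lt_append (forall_lt_append (forall_lt_append (forall_lt_append (forall_lt_append (forall_lt_append (forall_lt_append (forall_lt_append (forall_lt_append (forall_lt_append (forall_lt_append (forall_lt_append (forall_lt_append (forall_lt_append (forall_lt_zero) (forall_lt_single 0 autBlkZ_0)) (forall_lt_single 1 autBlkZ_1)) (forall_lt_single 2 autBlkZ_2)) (forall_lt_single 3 autBlkZ_3)) (forall_lt_single 4 autBlkZ_4)) (forall_lt_single 5 autBlkZ_5)) (forall_lt_single 6 autBlkZ_6)) (forall_lt_single 7 autBlkZ_7)) (forall_lt_single 8 autBlkZ_8)) (forall_lt_single 9 autBlkZ_9)) (forall_lt_single 10 autBlkZ_10)) (forall_lt_single 11 autBlkZ_11)) (forall_lt_single 12 autBlkZ_12)) (forall_lt_single 13 autBlkZ_13)) (forall_lt_single 14 autBlkZ_14)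

end Summit.Ventures.QEC.Census.BB144
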